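import Summits.PneNP.PneNP.Theorems.ExpanderLinearGeneratorsResKWidth
import Summits.PneNP.PneNP.Theorems.ExpanderLinearGeneratorsResKProb
import HarnessLib

/-!
# The n-free resolution-size rung for expanding linear systems, II: counting restrictions

Support file for crux `stmt-PneNP-11442` (`ExpansionForcesDepthFregeSize`). The probabilistic
half of the n-free size law for resolution (file I is the deterministic core): over the uniform
space of samples `(u, y)`, `u : Fin n → Fin (K+1)` (a variable `v < n` is ASSIGNED iff `u v = 0`,
probability `1/(K+1)`) and `y : Fin n → Bool` (its value), with all variables `≥ n` assigned
`false`,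

* a row of support `≤ ℓ` is OVERLOADED (more than `L` of its variables assigned) on at most a
  `2^ℓ / (K+1)^{L+1}` fraction of the space (`card_overload_le`);
* a line that stays unsatisfied with more than `W` unassigned literals mentions more than `W/2`
  variables `< n`, on each of which the sample avoids the one value satisfying a literal of the
  line: at most a `((2K+1)/(2K+2))^{W/2+1}` fraction (`card_survive_le`);
* with file I this gives the MASTER INEQUALITY of the restriction method in n-free form
  (`one_le_length_mul`): for every resolution refutation `π` of the XOR-CNF of an `ℓ`-sparse
  system whose supports form an `(r, c)`-boundary expander, every `L < c`, `W < (c - L) r / 2`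
  and every `K`,
  `1 ≤ |π| · (2^ℓ / (K+1)^{L+1} + ((2K+1)/(2K+2))^{W/2+1})`,
  the first term being charged only to the rows whose clauses `π` downloads (at most `|π|` of
  them) — which is what makes the bound independent of `n` and `m`.

References: P. Beame, T. Pitassi, *Simplified and improved resolution lower bounds*, FOCS 1996
(the restriction method); E. Ben-Sasson, A. Wigderson, J. ACM 48 (2001), §3, Thm. 6.5.
-/

namespace Summit.PneNP.PneNP.Theorems.ResNFree

set_option linter.dupNamespace false -- `Summit.PneNP.PneNP.…`: summit = sub-problem (D-0017)

open Finset Literature.Computability.Complexity Literature.Computability.MetaComplexity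
open Summit.PneNP.PneNP.Theorems.ResKRestriction

/-! ### Two product counts -/

section Counting

variable {ι κ : Type*} [Fintype ι] [DecidableEq ι] [Fintype κ] [DecidableEq κ]

/-- **Functions avoiding one prescribed value on each point of `P`** number at most
`(|κ| - 1)^{|P|} |κ|^{|ι| - |P|}` (exact product count over `Fintype.piFinset`). [folklore] -/
theorem card_le_of_forall_ne (P : Finset ι) (g : ι → κ) (s : Finset (ι → κ))
    (hs : ∀ f ∈ s, ∀ i ∈ P, f i ≠ g i) :
    s.card ≤ (Fintype.card κ - 1) ^ P.card * Fintype.card κ ^ (Fintype.card ι - P.card) := by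
  classical
  set t : ι → Finset κ := fun i => if i ∈ P then univ.erase (g i) else univ with ht
  have hsub : s ⊆ Fintype.piFinset t := by
    intro f hf
    rw [Fintype.mem_piFinset]
    intro i
    by_cases hi : i ∈ P
    · simp only [ht, if_pos hi]
      exact Finset.mem_erase.2 ⟨hs f hf i hi, Finset.mem_univ _⟩
    · simp only [ht, if_neg hi]; exact Finset.mem_univ _
  refine (Finset.card_le_card hsub).trans (le_of_eq ?_)
  rw [Fintype.card_piFinset]
  have h1 : ∀ i, (t i).card = if i ∈ P then Fintype.card κ - 1 else Fintype.card κ := by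
    intro i
    by_cases hi : i ∈ P
    · simp only [ht, if_pos hi, Finset.card_erase_of_mem (Finset.mem_univ _), Finset.card_univ]
    · simp only [ht, if_neg hi, Finset.card_univ]
  simp_rw [h1]
  rw [Finset.prod_ite, Finset.prod_const, Finset.prod_const]
  congr 2
  · rw [Finset.filter_mem_eq_inter, Finset.univ_inter]
  · rw [Finset.filter_not, Finset.filter_mem_eq_inter, Finset.univ_inter, Finset.card_univ_sdiff]

/-- **Functions with a prescribed value on each point of `P`** number at most `|κ|^{|ι| - |P|}`
(`ResKRestriction.card_filter_eqOn`). [folklore] -/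
theorem card_le_of_forall_eq (P : Finset ι) (g : ι → κ) (s : Finset (ι → κ))
    (hs : ∀ f ∈ s, ∀ i ∈ P, f i = g i) :
    s.card ≤ Fintype.card κ ^ (Fintype.card ι - P.card) := by
  classical
  rw [← card_filter_eqOn P g]
  exact Finset.card_le_card fun f hf => Finset.mem_filter.2 ⟨Finset.mem_univ _, hs f hf⟩

end Counting

/-! ### The sample space -/

variable {m n : ℕ}

/-- The size of the sample space. [folklore] -/
theorem card_sample (n K : ℕ) :
    Fintype.card ((Fin n → Fin (K + 1)) × (Fin n → Bool)) = (K + 1) ^ n * 2 ^ n := by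
  simp [Fintype.card_prod, Fintype.card_fin, Fintype.card_bool]

/-- **Overloaded rows are rare.** For a row support `S` of size `≤ ℓ`, the samples assigning more
than `L` variables of `S` (i.e. with `u v = 0` for at least `L + 1` points `v ∈ S`) form at most a
`2^ℓ/(K+1)^{L+1}` fraction of the space. [Beame–Pitassi 1996; folklore] -/
theorem card_overload_le {K ℓ L : ℕ} (S : Finset (Fin n)) (hS : S.card ≤ ℓ)
    (s : Finset ((Fin n → Fin (K + 1)) × (Fin n → Bool)))
    (hs : ∀ ω ∈ s, L + 1 ≤ (S.filter fun j => ω.1 j = 0).card) :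
    (s.card : ℝ) * ((K : ℝ) + 1) ^ (L + 1) ≤ (2 : ℝ) ^ ℓ * ((K + 1) ^ n * 2 ^ n : ℕ) := by
  classical
  -- if `n < L + 1` no sample is overloaded
  by_cases hn : L + 1 ≤ n
  swap
  · have hs0 : s = ∅ := by
      rw [Finset.eq_empty_iff_forall_notMem]
      intro ω hω
      have h1 := hs ω hω
      have h2 : (S.filter fun j => ω.1 j = 0).card ≤ n :=
        (Finset.card_le_univ _).trans (by rw [Fintype.card_fin])
      omega
    rw [hs0, Finset.card_empty]
    push_cast
    rw [zero_mul]
    positivity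
  -- cover `s` by the sub-families with `L + 1` prescribed zeros
  set B : Finset (Fin n) → Finset ((Fin n → Fin (K + 1)) × (Fin n → Bool)) :=
    fun T => univ.filter fun ω => ∀ j ∈ T, ω.1 j = 0 with hB
  have hmemB : ∀ T ω, ω ∈ B T ↔ ∀ j ∈ T, ω.1 j = 0 := fun T ω => by simp [hB]
  have hcov : s ⊆ (S.powersetCard (L + 1)).biUnion B := by
    intro ω hω
    obtain ⟨T, hT, hTc⟩ := Finset.exists_subset_card_eq (hs ω hω)
    refine Finset.mem_biUnion.2 ⟨T, Finset.mem_powersetCard.2 ⟨hT.trans (Finset.filter_subset _ _),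
      hTc⟩, (hmemB T ω).2 fun j hj => (Finset.mem_filter.1 (hT hj)).2⟩
  have hone : ∀ T ∈ S.powersetCard (L + 1), (B T).card ≤ (K + 1) ^ (n - (L + 1)) * 2 ^ n := by
    intro T hT
    have hTc : T.card = L + 1 := (Finset.mem_powersetCard.1 hT).2
    -- project to the pair (first component, second component)
    have hsub : B T ⊆ (univ.filter fun u : Fin n → Fin (K + 1) => ∀ j ∈ T, u j = 0) ×ˢ
        (univ : Finset (Fin n → Bool)) := by
      intro ω hω
      rw [Finset.mem_product]
      exact ⟨Finset.mem_filter.2 ⟨Finset.mem_univ _, (hmemB T ω).1 hω⟩, Finset.mem_univ _⟩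
    refine (Finset.card_le_card hsub).trans ?_
    rw [Finset.card_product, Finset.card_univ, Fintype.card_fun, Fintype.card_fin, Fintype.card_bool]
    refine Nat.mul_le_mul_right _ ?_
    have h := card_le_of_forall_eq T (fun _ => (0 : Fin (K + 1)))
      (univ.filter fun u : Fin n → Fin (K + 1) => ∀ j ∈ T, u j = 0)
      (fun f hf => (Finset.mem_filter.1 hf).2)
    rwa [Fintype.card_fin, Fintype.card_fin, hTc] at h
  have hcount : s.card ≤ 2 ^ ℓ * ((K + 1) ^ (n - (L + 1)) * 2 ^ n) :=
    calc s.card ≤ ((S.powersetCard (L + 1)).biUnion B).card := Finset.card_le_card hcov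
      _ ≤ ∑ T ∈ S.powersetCard (L + 1), (B T).card := Finset.card_biUnion_le
      _ ≤ ∑ T ∈ S.powersetCard (L + 1), (K + 1) ^ (n - (L + 1)) * 2 ^ n := Finset.sum_le_sum hone
      _ = (S.card.choose (L + 1)) * ((K + 1) ^ (n - (L + 1)) * 2 ^ n) := by
          rw [Finset.sum_const, smul_eq_mul, Finset.card_powersetCard]
      _ ≤ 2 ^ ℓ * ((K + 1) ^ (n - (L + 1)) * 2 ^ n) := by
          refine Nat.mul_le_mul_right _ ?_
          exact (Nat.choose_le_two_pow _ _).trans (Nat.pow_le_pow_right (by norm_num) hS)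
  -- compare with the whole space
  have h1 : (s.card : ℝ) ≤ (2 : ℝ) ^ ℓ * (((K : ℝ) + 1) ^ (n - (L + 1)) * 2 ^ n) := by
    exact_mod_cast hcount
  have h2 : ((K : ℝ) + 1) ^ (n - (L + 1)) * ((K : ℝ) + 1) ^ (L + 1) = ((K : ℝ) + 1) ^ n := by
    rw [← pow_add, Nat.sub_add_cancel hn]
  have hK : (0 : ℝ) < (K : ℝ) + 1 := by positivity
  calc (s.card : ℝ) * ((K : ℝ) + 1) ^ (L + 1)
      ≤ (2 : ℝ) ^ ℓ * (((K : ℝ) + 1) ^ (n - (L + 1)) * 2 ^ n) * ((K : ℝ) + 1) ^ (L + 1) :=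
        mul_le_mul_of_nonneg_right h1 (by positivity)
    _ = (2 : ℝ) ^ ℓ * ((K + 1) ^ n * 2 ^ n : ℕ) := by
        push_cast
        rw [← h2]
        ring

/-- **Unsatisfied wide lines are rare.** Fix a clause `C` and, for a sample `(u, y)`, the
restriction assigning `y v` to the variables `v < n` with `u v = 0` and `false` to all variables
`≥ n`. The samples under which `C` is not satisfied but keeps more than `W` unassigned literals
form at most a `((2K+1)/(2K+2))^{W/2+1}` fraction of the space: such a `C` has literals on more than
`W/2` variables `< n`, and on each of them the sample avoids the one value (assigned, with the
polarity of a literal of `C`) that would satisfy `C`. [Beame–Pitassi 1996; folklore] -/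
theorem card_survive_le {K W : ℕ} (C : Finset (Literal ℕ))
    (s : Finset ((Fin n → Fin (K + 1)) × (Fin n → Bool)))
    (hs : ∀ ω ∈ s,
      ¬ SatisfiedBy (fun v => if h : v < n then (if ω.1 ⟨v, h⟩ = 0 then some (ω.2 ⟨v, h⟩) else none)
        else some false) C ∧
      W < (restrictClause (fun v => if h : v < n then
        (if ω.1 ⟨v, h⟩ = 0 then some (ω.2 ⟨v, h⟩) else none) else some false) C).card) :
    (s.card : ℝ) ≤ ((2 * (K : ℝ) + 1) / (2 * K + 2)) ^ (W / 2 + 1) * ((K + 1) ^ n * 2 ^ n : ℕ) := by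
  classical
  rcases s.eq_empty_or_nonempty with rfl | ⟨ω₀, hω₀⟩
  · simp only [Finset.card_empty, Nat.cast_zero]; positivity
  -- the variables `< n` of `C` and the satisfying values
  set V : Finset (Fin n) := univ.filter fun j => ((j : ℕ), true) ∈ C ∨ ((j : ℕ), false) ∈ C
    with hV
  set g : Fin n → Fin (K + 1) × Bool := fun j => (0, decide (((j : ℕ), true) ∈ C)) with hg
  have hgC : ∀ j ∈ V, (((j : ℕ), (g j).2) : Literal ℕ) ∈ C := by
    intro j hj
    have hj' := (Finset.mem_filter.1 hj).2
    by_cases ht : ((j : ℕ), true) ∈ C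
    · simp [hg, ht]
    · simpa [hg, ht] using hj'.resolve_left ht
  -- (i) a surviving sample has many variables of `C` below `n`
  have hwide : ∀ ω ∈ s, W < 2 * V.card := by
    intro ω hω
    obtain ⟨-, hW⟩ := hs ω hω
    refine lt_of_lt_of_le hW ?_
    have hsub : restrictClause (fun v => if h : v < n then
          (if ω.1 ⟨v, h⟩ = 0 then some (ω.2 ⟨v, h⟩) else none) else some false) C
        ⊆ (V ×ˢ (univ : Finset Bool)).image fun p => (((p.1 : ℕ), p.2) : Literal ℕ) := by
      intro l hl
      obtain ⟨hlC, hnone⟩ := mem_restrictClause.1 hl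
      have hln : l.1 < n := by
        by_contra h
        simp [h] at hnone
      refine Finset.mem_image.2 ⟨(⟨l.1, hln⟩, l.2), Finset.mem_product.2 ⟨?_, Finset.mem_univ _⟩, ?_⟩
      · refine Finset.mem_filter.2 ⟨Finset.mem_univ _, ?_⟩
        rcases hb : l.2 with _ | _
        · right; have : l = (l.1, false) := by ext <;> simp [hb]
          rw [this] at hlC; exact hlC
        · left; have : l = (l.1, true) := by ext <;> simp [hb]
          rw [this] at hlC; exact hlC
      · ext <;> simp
    calc (restrictClause _ C).card
        ≤ ((V ×ˢ (univ : Finset Bool)).image fun p => (((p.1 : ℕ), p.2) : Literal ℕ)).card :=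
          Finset.card_le_card hsub
      _ ≤ (V ×ˢ (univ : Finset Bool)).card := Finset.card_image_le
      _ = 2 * V.card := by rw [Finset.card_product, Finset.card_univ, Fintype.card_bool, mul_comm]
  have hq : W / 2 + 1 ≤ V.card := by
    have := hwide ω₀ hω₀
    omega
  -- (ii) a surviving sample avoids the satisfying value on every variable of `C` below `n`
  have havoid : ∀ ω ∈ s, ∀ j ∈ V, (fun j => (ω.1 j, ω.2 j)) j ≠ g j := by
    intro ω hω j hj heq
    obtain ⟨hns, -⟩ := hs ω hω
    simp only [hg, Prod.mk.injEq] at heq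
    obtain ⟨h0, hval⟩ := heq
    refine hns ⟨((j : ℕ), (g j).2), hgC j hj, ?_⟩
    simp only [hg, j.2, ↓reduceDIte, Fin.eta, h0, ↓reduceIte, hval]
  -- count through the injection `ω ↦ (v ↦ (u v, y v))`
  have hinj : Set.InjOn (fun ω : (Fin n → Fin (K + 1)) × (Fin n → Bool) =>
      (fun j => (ω.1 j, ω.2 j) : Fin n → Fin (K + 1) × Bool)) ↑s := by
    intro ω _ ω' _ h
    have h' : ∀ j, (ω.1 j, ω.2 j) = (ω'.1 j, ω'.2 j) := fun j => congrFun h j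
    ext j
    · exact congrArg Fin.val (Prod.mk.inj (h' j)).1
    · exact (Prod.mk.inj (h' j)).2
  have hcard : s.card ≤ (Fintype.card (Fin (K + 1) × Bool) - 1) ^ V.card *
      Fintype.card (Fin (K + 1) × Bool) ^ (Fintype.card (Fin n) - V.card) := by
    rw [← Finset.card_image_of_injOn hinj]
    refine card_le_of_forall_ne V g _ fun f hf => ?_
    obtain ⟨ω, hω, rfl⟩ := Finset.mem_image.1 hf
    exact havoid ω hω
  rw [Fintype.card_prod, Fintype.card_fin, Fintype.card_bool, Fintype.card_fin] at hcard
  -- arithmetic: `(2K+1)^v (2K+2)^{n-v} ≤ ((2K+1)/(2K+2))^{W/2+1} (K+1)^n 2^n`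
  have hvn : V.card ≤ n := (Finset.card_le_univ _).trans (by rw [Fintype.card_fin])
  have h1 : (s.card : ℝ) ≤ ((2 * (K : ℝ) + 1)) ^ V.card * (2 * (K : ℝ) + 2) ^ (n - V.card) := by
    have : ((K + 1) * 2 - 1 : ℕ) = 2 * K + 1 := by omega
    rw [this] at hcard
    have h := hcard
    have : ((K + 1) * 2 : ℕ) = 2 * K + 2 := by ring
    rw [this] at h
    exact_mod_cast h
  have hpos : (0 : ℝ) < 2 * (K : ℝ) + 2 := by positivity
  have hratio : (2 * (K : ℝ) + 1) ^ V.card * (2 * (K : ℝ) + 2) ^ (n - V.card)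
      = ((2 * (K : ℝ) + 1) / (2 * K + 2)) ^ V.card * (2 * (K : ℝ) + 2) ^ n := by
    rw [div_pow, div_mul_eq_mul_div, eq_div_iff (by positivity), mul_assoc, ← pow_add,
      Nat.sub_add_cancel hvn]
  have hle1 : (2 * (K : ℝ) + 1) / (2 * K + 2) ≤ 1 := by
    rw [div_le_one hpos]; linarith
  have hge0 : (0 : ℝ) ≤ (2 * (K : ℝ) + 1) / (2 * K + 2) := by positivity
  have hpow : ((2 * (K : ℝ) + 1) / (2 * K + 2)) ^ V.card ≤ ((2 * (K : ℝ) + 1) / (2 * K + 2)) ^ (W / 2 + 1) :=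
    pow_le_pow_of_le_one hge0 hle1 hq
  have hΩ : ((2 * (K : ℝ) + 2)) ^ n = ((K + 1) ^ n * 2 ^ n : ℕ) := by
    push_cast
    rw [← mul_pow]; ring
  calc (s.card : ℝ) ≤ ((2 * (K : ℝ) + 1)) ^ V.card * (2 * (K : ℝ) + 2) ^ (n - V.card) := h1
    _ = ((2 * (K : ℝ) + 1) / (2 * K + 2)) ^ V.card * (2 * (K : ℝ) + 2) ^ n := hratio
    _ ≤ ((2 * (K : ℝ) + 1) / (2 * K + 2)) ^ (W / 2 + 1) * (2 * (K : ℝ) + 2) ^ n :=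
        mul_le_mul_of_nonneg_right hpow (by positivity)
    _ = ((2 * (K : ℝ) + 1) / (2 * K + 2)) ^ (W / 2 + 1) * ((K + 1) ^ n * 2 ^ n : ℕ) := by rw [hΩ]

end Summit.PneNP.PneNP.Theorems.ResNFree
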